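import Literature.MathematicalPhysics.QuantumLattice.HubbardTTPrimeGrandCanonicalPressureZeeman
import Literature.MathematicalPhysics.QuantumLattice.CanonicalClassChemicalPotential
import HarnessLib

/-!
# The canonical pressure of the 2D `t–t'` Hubbard model in a Zeeman field as a NUMBER:
# `p(β; t,t',U; n, h) = sup_{n↑ + n↓ = n} [p(β; n↑, n↓) + βh(n↑ − n↓)]`, its a-priori window, and the
# Legendre square with the grand-canonical Zeeman pressure

Topic `MathematicalPhysics/QuantumLattice` (family `hubbard`; Hubbard material-oracle programme, stage S2 (iii)
`T > 0` and the `T × H` axes of the per-material phase map). Companion of `HubbardTTPrimeThermalPressureSpinSectors`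
(the spin-resolved canonical pressure `pressureTT'₂ β t t' U x y`, `(x, y) = (n↑, n↓) ∈ [0,1)²`),
`…SpinSectorsConcave` (spin exchange, joint concavity, `S^z = 0` dominance `p(x,y) ≤ pressureTT' (x+y)`) and
`HubbardTTPrimeGrandCanonicalPressureZeeman` (`P(μ,h) = gcPressureTT'Zeeman = sup_{x,y}[p(x,y) + βμ(x+y) + βh(x−y)]`).
The canonical ensemble at filling `n` in a Zeeman field `h` (coupled to `N↑ − N↓`, the tree's `spinImbalance`) sums
the spin sectors of filling `n` with weights `e^{βh(N↑ − N↓)}`; in the thermodynamic limit the largest sector wins, so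
its pressure is the number `pressureTT'Zeeman β t t' U n h := sup {p(β; x, n − x) + βh(2x − n) : x ∈ spinFibre n}`,
`spinFibre n = {x : 0 ≤ x < 1, 0 ≤ n − x < 1}` (the identification with the fixed-filling torus partition function
in a field is the sequel `HubbardTTPrimeThermalPressureZeemanLimit`). For `β ≥ 0`, `U ≥ 0`, `0 ≤ n < 2`:

* §1 every fibre term is below the number, the `iff` for ceilings, `ε`-dominant sectors exist; the `m = 0` FLOOR
  `pressureTT' n ≤ p(n,h)` and the `S^z`-dominance CAP `p(n,h) ≤ pressureTT' n + β|h|·min(n, 2−n)`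
  (`|n↑ − n↓| ≤ min(n, 2−n)` on the fibre); `p(n,0) = pressureTT' n`; `p(n,−h) = p(n,h)`; convex and
  `β·min(n,2−n)`-Lipschitz in `h`; the A-PRIORI WINDOW `−β e(n) ≤ p(n,h) ≤ 2H_b(n/2) − β e(n) + β|h|·min(n,2−n)`
  (`e = energyDensityTT'`, `H_b = Real.binEntropy`), i.e. `e(n) − |h|·min(n,2−n) − 2H_b(n/2)·T ≤ f(T,h) ≤ e(n)` for the
  free energy `f = −p/β` — the `(T, h)` annex of every certified `T = 0` energy word, certificate-free; concavity in `n`;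
* §2 the LEGENDRE SQUARE: `p(n,h) + βμn ≤ P(μ,h)`; `P(μ,h) = sup_{0 ≤ n < 2} [p(n,h) + βμn]`; at `β > 0`, `0 < n < 2`
  a supporting chemical potential exists, `P(μ,h) = p(n,h) + βμn`, and `p(n,h) = inf_μ [P(μ,h) − βμn]`.
Griffiths brackets in the field and the thermodynamic-limit identification are the sequels `…ZeemanBrackets` /
`…ZeemanLimit`.
HONEST SCOPE: numbers only (no state class in a field is introduced); no certificate value; no phase word. Two
definitions with body (`spinFibre`, `pressureTT'Zeeman`); everything else PROVED, 0 sorry.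

## Mathlib / tree search
`lean search 'pressureTT.*Zeeman|canonical.*Zeeman|spinFibre'` (2026-08-28): only the GRAND-canonical
`gcPressureTT'Zeeman` — no fixed-filling field number. REUSED: `pressureTT'₂_le_pressureTT'`, `pressureTT'₂_swap`,
`pressureTT'₂_half_half`, `concaveOn_pressureTT'₂`, `pressureTT'₂_add_le_gcPressureTT'Zeeman`, `gcPressureTT'Zeeman_le_iff`,
`pressureTT'_mem_Icc`, `ConvexOn.exists_supporting_slope` (`CanonicalClassChemicalPotential`); Mathlib `le_csSup`,
`csSup_le_iff`, `exists_lt_of_lt_csSup`, `ConcaveOn.neg`, `Real.binEntropy_le_log_two`, `Real.log_two_lt_d9`.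

## References
* D. Ruelle, *Statistical Mechanics: Rigorous Results* (1969), §3.4. [cite: Ruelle1969, §3.4]
* R. B. Israel, *Convexity in the Theory of Lattice Gases* (1979), Thm. I.2.4, §I.3. [cite: Israel1979, Thm. I.2.4]
* R. B. Griffiths, J. Math. Phys. 5 (1964) 1215, Appendix (convexity lemma). [cite: Griffiths1964, Appendix]
* E. H. Lieb, Phys. Rev. Lett. 62 (1989) 1201, proof of Thm. 1. [cite: LiebPRL1989, proof of Theorem 1]
* R. T. Rockafellar, *Convex Analysis* (1970), Thm. 12.2, Thm. 23.4. [cite: Rockafellar1970, Thm. 12.2]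
-/

noncomputable section

namespace Literature.MathematicalPhysics.QuantumLattice

namespace ThermodynamicLimit

open _root_.Filter Set
open scoped _root_.Topology

/-! ### §0 The fibre of spin densities of a given filling -/

/-- **The spin fibre of filling `n`**: the up-densities `x` with `(x, n − x) ∈ [0,1)²`, i.e. the spin sectors
`(n↑, n↓) = (x, n − x)` of total filling `n` for which `pressureTT'₂` is defined. [cite: Ruelle1969, §3.4] -/
def spinFibre (n : ℝ) : Set ℝ := {x : ℝ | 0 ≤ x ∧ x < 1 ∧ 0 ≤ n - x ∧ n - x < 1}

/-- The unpolarised sector `x = n/2` lies on the fibre (`0 ≤ n < 2`). [cite: Ruelle1969, §3.4] -/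
theorem half_mem_spinFibre {n : ℝ} (hn0 : 0 ≤ n) (hn2 : n < 2) : n / 2 ∈ spinFibre n :=
  ⟨by linarith, by linarith, by linarith, by linarith⟩

/-- **Kinematic magnetisation bound on the fibre**: `|n↑ − n↓| = |2x − n| ≤ min(n, 2 − n)`. [cite: LiebPRL1989, proof of Theorem 1] -/
theorem abs_two_mul_sub_le_of_mem_spinFibre {n x : ℝ} (hx : x ∈ spinFibre n) : |2 * x - n| ≤ min n (2 - n) := by
  obtain ⟨h0, h1, h2, h3⟩ := hx
  rw [abs_le, le_min_iff]
  refine ⟨?_, by linarith, by linarith⟩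
  rcases le_total n (2 - n) with h | h
  · rw [min_eq_left h]; linarith
  · rw [min_eq_right h]; linarith

/-- The Zeeman term of a fibre sector is at most `β|c|·min(n, 2−n)` (`β ≥ 0`). [cite: LiebPRL1989, proof of Theorem 1] -/
theorem field_term_le {β n x : ℝ} (hβ : 0 ≤ β) (c : ℝ) (hx : x ∈ spinFibre n) :
    β * c * (2 * x - n) ≤ β * |c| * min n (2 - n) := by
  have e1 : β * c * (2 * x - n) ≤ |β * c * (2 * x - n)| := le_abs_self _
  rw [abs_mul, abs_mul, abs_of_nonneg hβ] at e1
  exact e1.trans (mul_le_mul_of_nonneg_left (abs_two_mul_sub_le_of_mem_spinFibre hx) (by positivity))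

/-- The fibre is convex in the joint variable: a convex combination of `x₁ ∈ spinFibre n₁`, `x₂ ∈ spinFibre n₂`
lies on the fibre of the combined filling. [cite: Ruelle1969, §3.4] -/
theorem convexComb_mem_spinFibre {n₁ n₂ x₁ x₂ a b : ℝ} (h₁ : x₁ ∈ spinFibre n₁) (h₂ : x₂ ∈ spinFibre n₂)
    (ha : 0 ≤ a) (hb : 0 ≤ b) (hab : a + b = 1) : a * x₁ + b * x₂ ∈ spinFibre (a * n₁ + b * n₂) := by
  obtain ⟨h10, h11, h12, h13⟩ := h₁
  obtain ⟨h20, h21, h22, h23⟩ := h₂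
  refine ⟨by positivity, ?_, by nlinarith, ?_⟩
  · rcases le_total x₁ x₂ with h | h
    · nlinarith
    · nlinarith
  · rcases le_total (n₁ - x₁) (n₂ - x₂) with h | h
    · nlinarith
    · nlinarith

/-! ### §1 The canonical pressure in a Zeeman field -/

/-- **The canonical pressure of the 2D `t–t'` Hubbard model at filling `n` in a Zeeman field `h`** (coupled to
`N↑ − N↓`): `p(β; t,t',U; n, h) = sup_{x ∈ spinFibre n} [pressureTT'₂ β t t' U x (n − x) + βh(2x − n)]` — the
Laplace/Legendre value over the spin sectors of filling `n`; it is the thermodynamic limit of the fixed-filling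
torus partition function in the field (sequel file). [cite: Ruelle1969, §3.4] -/
def pressureTT'Zeeman (β t t' U n hz : ℝ) : ℝ :=
  sSup ((fun x : ℝ => pressureTT'₂ β t t' U x (n - x) + β * hz * (2 * x - n)) '' spinFibre n)

section Number

variable {β : ℝ} (hβ : 0 ≤ β) (t t' : ℝ) {U : ℝ} (hU : 0 ≤ U) {n : ℝ} (hn0 : 0 ≤ n) (hn2 : n < 2)
include hβ hU

/-- Every fibre term is below the `S^z = 0`-dominance ceiling `pressureTT' n + β|h|·min(n,2−n)`.
[cite: LiebPRL1989, proof of Theorem 1] -/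
theorem fibreTerm_le_pressureTT'_add (hz : ℝ) {x : ℝ} (hx : x ∈ spinFibre n) :
    pressureTT'₂ β t t' U x (n - x) + β * hz * (2 * x - n) ≤
      pressureTT' β t t' U n + β * |hz| * min n (2 - n) := by
  obtain ⟨h0, h1, h2, h3⟩ := hx
  have hp := pressureTT'₂_le_pressureTT' hβ t t' hU h0 h1 h2 h3
  rw [show x + (n - x) = n by ring] at hp
  linarith [field_term_le hβ hz ⟨h0, h1, h2, h3⟩]

/-- The fibre set of values is bounded above. [cite: Ruelle1969, §3.4] -/
theorem bddAbove_zeemanFibreSet (hz : ℝ) :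
    BddAbove ((fun x : ℝ => pressureTT'₂ β t t' U x (n - x) + β * hz * (2 * x - n)) '' spinFibre n) := by
  refine ⟨pressureTT' β t t' U n + β * |hz| * min n (2 - n), ?_⟩
  rintro _ ⟨x, hx, rfl⟩
  exact fibreTerm_le_pressureTT'_add hβ t t' hU hz hx

/-- **Every spin sector of filling `n` is below the number**: `p(x, n−x) + βh(2x−n) ≤ p(n,h)` for `x ∈ spinFibre n`.
[cite: Ruelle1969, §3.4] -/
theorem le_pressureTT'Zeeman (hz : ℝ) {x : ℝ} (hx : x ∈ spinFibre n) :
    pressureTT'₂ β t t' U x (n - x) + β * hz * (2 * x - n) ≤ pressureTT'Zeeman β t t' U n hz :=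
  le_csSup (bddAbove_zeemanFibreSet hβ t t' hU hz) ⟨x, hx, rfl⟩

include hn0 hn2 in
/-- **Ceilings**: `p(n,h) ≤ q` iff every fibre term is `≤ q`. [cite: Ruelle1969, §3.4] -/
theorem pressureTT'Zeeman_le_iff (hz : ℝ) {q : ℝ} :
    pressureTT'Zeeman β t t' U n hz ≤ q ↔
      ∀ x ∈ spinFibre n, pressureTT'₂ β t t' U x (n - x) + β * hz * (2 * x - n) ≤ q := by
  have hne : ((fun x : ℝ => pressureTT'₂ β t t' U x (n - x) + β * hz * (2 * x - n)) '' spinFibre n).Nonempty :=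
    ⟨_, ⟨n / 2, half_mem_spinFibre hn0 hn2, rfl⟩⟩
  rw [pressureTT'Zeeman, csSup_le_iff (bddAbove_zeemanFibreSet hβ t t' hU hz) hne]
  constructor
  · intro h x hx
    exact h _ ⟨x, hx, rfl⟩
  · rintro h _ ⟨x, hx, rfl⟩
    exact h x hx

omit hβ hU in
include hn0 hn2 in
/-- **Dominant sectors exist at every tolerance**: for `ε > 0` some `x ∈ spinFibre n` is `ε`-dominant,
`p(n,h) − ε ≤ p(x,n−x) + βh(2x−n)`. [cite: Ruelle1969, §3.4] -/
theorem exists_dominant (hz : ℝ) {ε : ℝ} (hε : 0 < ε) :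
    ∃ x ∈ spinFibre n, pressureTT'Zeeman β t t' U n hz - ε ≤
      pressureTT'₂ β t t' U x (n - x) + β * hz * (2 * x - n) := by
  have hne : ((fun x : ℝ => pressureTT'₂ β t t' U x (n - x) + β * hz * (2 * x - n)) '' spinFibre n).Nonempty :=
    ⟨_, ⟨n / 2, half_mem_spinFibre hn0 hn2, rfl⟩⟩
  obtain ⟨_, ⟨x, hx, rfl⟩, h⟩ := exists_lt_of_lt_csSup hne
    (show pressureTT'Zeeman β t t' U n hz - ε < pressureTT'Zeeman β t t' U n hz by linarith)
  exact ⟨x, hx, h.le⟩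

include hn0 hn2 in
/-- **The `m = 0` floor**: `pressureTT' β t t' U n ≤ p(n,h)` (the unpolarised sector `x = n/2` is on the fibre and
feels no field). [cite: LiebPRL1989, proof of Theorem 1] -/
theorem pressureTT'_le_pressureTT'Zeeman (hz : ℝ) : pressureTT' β t t' U n ≤ pressureTT'Zeeman β t t' U n hz := by
  have h := le_pressureTT'Zeeman hβ t t' hU hz (half_mem_spinFibre hn0 hn2)
  rw [show n - n / 2 = n / 2 by ring, pressureTT'₂_half_half hβ t t' hU hn0 hn2] at h
  have e : β * hz * (2 * (n / 2) - n) = 0 := by ring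
  linarith

include hn0 hn2 in
/-- **The `S^z`-dominance cap**: `p(n,h) ≤ pressureTT' β t t' U n + β|h|·min(n, 2−n)` (every sector is dominated by
the `S^z = 0` sector of its filling, and `|n↑ − n↓| ≤ min(n, 2−n)`). [cite: LiebPRL1989, proof of Theorem 1] -/
theorem pressureTT'Zeeman_le_pressureTT'_add (hz : ℝ) :
    pressureTT'Zeeman β t t' U n hz ≤ pressureTT' β t t' U n + β * |hz| * min n (2 - n) :=
  (pressureTT'Zeeman_le_iff hβ t t' hU hn0 hn2 hz).2 fun _ hx => fibreTerm_le_pressureTT'_add hβ t t' hU hz hx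

include hn0 hn2 in
/-- **Zero field**: `p(n, 0) = pressureTT' β t t' U n`, the canonical number of record. [cite: Ruelle1969, §3.4] -/
theorem pressureTT'Zeeman_zero : pressureTT'Zeeman β t t' U n 0 = pressureTT' β t t' U n := by
  refine le_antisymm ?_ (pressureTT'_le_pressureTT'Zeeman hβ t t' hU hn0 hn2 0)
  have h := pressureTT'Zeeman_le_pressureTT'_add hβ t t' hU hn0 hn2 (0 : ℝ)
  simpa using h

include hn0 hn2 in
/-- **Evenness in the field**: `p(n, −h) = p(n, h)` (spin exchange `x ↦ n − x` maps the fibre to itself and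
`p(x,y) = p(y,x)`). [cite: LiebPRL1989, proof of Theorem 1] -/
theorem pressureTT'Zeeman_neg (hz : ℝ) : pressureTT'Zeeman β t t' U n (-hz) = pressureTT'Zeeman β t t' U n hz := by
  have key : ∀ h : ℝ, pressureTT'Zeeman β t t' U n (-h) ≤ pressureTT'Zeeman β t t' U n h := by
    intro h
    rw [pressureTT'Zeeman_le_iff hβ t t' hU hn0 hn2]
    rintro x ⟨h0, h1, h2, h3⟩
    have hx' : n - x ∈ spinFibre n := ⟨h2, h3, by linarith, by linarith⟩
    have hle := le_pressureTT'Zeeman hβ t t' hU h hx'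
    rw [show n - (n - x) = x by ring, pressureTT'₂_swap hβ t t' hU h2 h3 h0 h1] at hle
    have e : β * h * (2 * (n - x) - n) = β * -h * (2 * x - n) := by ring
    linarith
  refine le_antisymm (key hz) ?_
  have h := key (-hz)
  rwa [neg_neg] at h

include hn0 hn2 in
/-- **Convexity in the field** (a supremum of affine functions of `h`). [cite: Griffiths1964, Appendix] -/
theorem convexOn_pressureTT'Zeeman_field :
    ConvexOn ℝ Set.univ (fun hz : ℝ => pressureTT'Zeeman β t t' U n hz) := by
  refine ⟨convex_univ, ?_⟩
  intro h₁ _ h₂ _ a b ha hb hab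
  simp only [smul_eq_mul]
  rw [pressureTT'Zeeman_le_iff hβ t t' hU hn0 hn2]
  intro x hx
  have e1 := le_pressureTT'Zeeman hβ t t' hU h₁ hx
  have e2 := le_pressureTT'Zeeman hβ t t' hU h₂ hx
  have e : pressureTT'₂ β t t' U x (n - x) + β * (a * h₁ + b * h₂) * (2 * x - n) =
      a * (pressureTT'₂ β t t' U x (n - x) + β * h₁ * (2 * x - n)) +
        b * (pressureTT'₂ β t t' U x (n - x) + β * h₂ * (2 * x - n)) := by
    have hb' : b = 1 - a := by linarith
    rw [hb']; ring
  rw [e]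
  exact add_le_add (mul_le_mul_of_nonneg_left e1 ha) (mul_le_mul_of_nonneg_left e2 hb)

include hn0 hn2 in
/-- **One-sided Lipschitz step in the field**: `p(n,h) ≤ p(n,h') + β|h − h'|·min(n, 2−n)`. [cite: Griffiths1964, Appendix] -/
theorem pressureTT'Zeeman_le_add_field (hz hz' : ℝ) :
    pressureTT'Zeeman β t t' U n hz ≤ pressureTT'Zeeman β t t' U n hz' + β * |hz - hz'| * min n (2 - n) := by
  rw [pressureTT'Zeeman_le_iff hβ t t' hU hn0 hn2]
  intro x hx
  have e1 := le_pressureTT'Zeeman hβ t t' hU hz' hx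
  have e2 := field_term_le hβ (hz - hz') hx
  have e : pressureTT'₂ β t t' U x (n - x) + β * hz * (2 * x - n) =
      (pressureTT'₂ β t t' U x (n - x) + β * hz' * (2 * x - n)) + β * (hz - hz') * (2 * x - n) := by ring
  linarith

include hn0 hn2 in
/-- **Lipschitz in the field**: `|p(n,h) − p(n,h')| ≤ β·|h − h'|·min(n, 2−n)`. [cite: Griffiths1964, Appendix] -/
theorem abs_pressureTT'Zeeman_sub_le (hz hz' : ℝ) :
    |pressureTT'Zeeman β t t' U n hz - pressureTT'Zeeman β t t' U n hz'| ≤ β * |hz - hz'| * min n (2 - n) := by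
  have h1 := pressureTT'Zeeman_le_add_field hβ t t' hU hn0 hn2 hz hz'
  have h2 := pressureTT'Zeeman_le_add_field hβ t t' hU hn0 hn2 hz' hz
  rw [abs_sub_comm hz' hz] at h2
  rw [abs_le]; constructor <;> linarith

include hn0 hn2 in
/-- **A-priori window** (the `(T, h)` annex of the ground-state energy):
`−β e(t,t',U,n) ≤ p(β; n, h) ≤ 2H_b(n/2) − β e(t,t',U,n) + β|h|·min(n, 2−n)`; in free-energy form `f = −p/β`:
`e(n) − |h|·min(n,2−n) − 2H_b(n/2)·T ≤ f(T, h) ≤ e(n)` at every `T > 0` and every field. [cite: Ruelle1969, §3.4] -/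
theorem pressureTT'Zeeman_mem_Icc (hz : ℝ) :
    pressureTT'Zeeman β t t' U n hz ∈ Set.Icc (-(β * energyDensityTT' t t' U n))
      (2 * Real.binEntropy (n / 2) - β * energyDensityTT' t t' U n + β * |hz| * min n (2 - n)) := by
  obtain ⟨hlo, hhi⟩ := pressureTT'_mem_Icc hβ t t' hU hn0 hn2
  exact ⟨hlo.trans (pressureTT'_le_pressureTT'Zeeman hβ t t' hU hn0 hn2 hz),
    (pressureTT'Zeeman_le_pressureTT'_add hβ t t' hU hn0 hn2 hz).trans (by linarith)⟩

include hn0 hn2 in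
/-- Decimal form of the ceiling (`2H_b(n/2) ≤ log 4 ≤ 1.3863`): `p(n,h) ≤ 1.3863 − β e(n) + β|h|·min(n,2−n)`, i.e.
`f(T,h) ≥ e(n) − |h|·min(n,2−n) − 1.3863·T`. [cite: Ruelle1969, §3.4] -/
theorem pressureTT'Zeeman_le_decimal (hz : ℝ) :
    pressureTT'Zeeman β t t' U n hz ≤ 1.3863 - β * energyDensityTT' t t' U n + β * |hz| * min n (2 - n) := by
  have h := (pressureTT'Zeeman_mem_Icc hβ t t' hU hn0 hn2 hz).2
  have hb : Real.binEntropy (n / 2) ≤ Real.log 2 := Real.binEntropy_le_log_two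
  have hl : Real.log 2 < 0.6931471808 := Real.log_two_lt_d9
  linarith

end Number

/-! #### Concavity in the filling -/

section Density

variable {β : ℝ} (hβ : 0 ≤ β) (t t' : ℝ) {U : ℝ} (hU : 0 ≤ U)
include hβ hU

/-- **Concavity in the filling**: `n ↦ p(β; n, h)` is concave on `[0, 2)` (the marginal supremum of the jointly
concave `(n↑,n↓) ↦ p(n↑,n↓)` plus a linear form, over the affine fibres). [cite: Ruelle1969, §3.4] -/
theorem concaveOn_pressureTT'Zeeman_density (hz : ℝ) :
    ConcaveOn ℝ (Set.Ico (0 : ℝ) 2) (fun n : ℝ => pressureTT'Zeeman β t t' U n hz) := by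
  refine ⟨convex_Ico 0 2, ?_⟩
  intro n₁ hn₁ n₂ hn₂ a b ha hb hab
  simp only [smul_eq_mul]
  have hn : a * n₁ + b * n₂ ∈ Set.Ico (0 : ℝ) 2 := (convex_Ico 0 2) hn₁ hn₂ ha hb hab
  refine le_of_forall_pos_le_add fun ε hε => ?_
  -- near-optimal sectors on the two fibres
  obtain ⟨x₁, hx₁, h₁⟩ := exists_dominant t t' hn₁.1 hn₁.2 (β := β) (U := U) hz hε
  obtain ⟨x₂, hx₂, h₂⟩ := exists_dominant t t' hn₂.1 hn₂.2 (β := β) (U := U) hz hε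
  -- the combined sector lies on the combined fibre
  have hx := convexComb_mem_spinFibre hx₁ hx₂ ha hb hab
  have hle := le_pressureTT'Zeeman hβ t t' hU hz hx
  -- joint concavity of `p(x, y)`
  have hc := (concaveOn_pressureTT'₂ hβ t t' hU).2 (x := (x₁, n₁ - x₁)) ⟨⟨hx₁.1, hx₁.2.1⟩, ⟨hx₁.2.2.1, hx₁.2.2.2⟩⟩
    (y := (x₂, n₂ - x₂)) ⟨⟨hx₂.1, hx₂.2.1⟩, ⟨hx₂.2.2.1, hx₂.2.2.2⟩⟩ ha hb hab
  simp only [smul_eq_mul, Prod.mk_add_mk, Prod.smul_mk] at hc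
  have e1 : a * n₁ + b * n₂ - (a * x₁ + b * x₂) = a * (n₁ - x₁) + b * (n₂ - x₂) := by ring
  rw [e1] at hle
  have e2 : β * hz * (2 * (a * x₁ + b * x₂) - (a * n₁ + b * n₂)) =
      a * (β * hz * (2 * x₁ - n₁)) + b * (β * hz * (2 * x₂ - n₂)) := by ring
  rw [e2] at hle
  have f1 := mul_le_mul_of_nonneg_left h₁ ha
  have f2 := mul_le_mul_of_nonneg_left h₂ hb
  have hε' : a * ε + b * ε = ε := by rw [← add_mul, hab, one_mul]
  nlinarith [hc, hle, f1, f2, hε']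

end Density

/-! ### §2 The Legendre square with the grand-canonical Zeeman pressure -/

section Legendre

variable {β : ℝ} (hβ : 0 ≤ β) (t t' : ℝ) {U : ℝ} (hU : 0 ≤ U)
include hβ hU

/-- **The canonical field number is below the grand-canonical one**: `p(n,h) + βμn ≤ P(μ,h)` (`0 ≤ n < 2`).
[cite: Ruelle1969, §3.4] -/
theorem pressureTT'Zeeman_add_le_gcPressureTT'Zeeman (μ hz : ℝ) {n : ℝ} (hn0 : 0 ≤ n) (hn2 : n < 2) :
    pressureTT'Zeeman β t t' U n hz + β * μ * n ≤ gcPressureTT'Zeeman β t t' U μ hz := by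
  rw [← le_sub_iff_add_le, pressureTT'Zeeman_le_iff hβ t t' hU hn0 hn2]
  rintro x ⟨h0, h1, h2, h3⟩
  have h := pressureTT'₂_add_le_gcPressureTT'Zeeman hβ t t' hU μ hz h0 h1 h2 h3
  have e : β * μ * (x + (n - x)) + β * hz * (x - (n - x)) = β * μ * n + β * hz * (2 * x - n) := by ring
  rw [e] at h
  linarith

/-- **`P(μ,h) = sup_{0 ≤ n < 2} [p(n,h) + βμn]`**: the grand-canonical Zeeman pressure is the Legendre transform in
the filling of the canonical field pressure (re-indexing the double supremum over the spin sectors by filling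
and fibre). [cite: Ruelle1969, §3.4] -/
theorem gcPressureTT'Zeeman_eq_sSup_pressureTT'Zeeman (μ hz : ℝ) :
    gcPressureTT'Zeeman β t t' U μ hz =
      sSup ((fun n : ℝ => pressureTT'Zeeman β t t' U n hz + β * μ * n) '' Set.Ico (0 : ℝ) 2) := by
  have hbdd : BddAbove ((fun n : ℝ => pressureTT'Zeeman β t t' U n hz + β * μ * n) '' Set.Ico (0 : ℝ) 2) := by
    refine ⟨gcPressureTT'Zeeman β t t' U μ hz, ?_⟩
    rintro _ ⟨n, hn, rfl⟩
    exact pressureTT'Zeeman_add_le_gcPressureTT'Zeeman hβ t t' hU μ hz hn.1 hn.2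
  refine le_antisymm ?_ ?_
  · rw [gcPressureTT'Zeeman_le_iff hβ t t' hU]
    intro x y hx0 hx1 hy0 hy1
    have hn : x + y ∈ Set.Ico (0 : ℝ) 2 := ⟨by linarith, by linarith⟩
    have hx : x ∈ spinFibre (x + y) := ⟨hx0, hx1, by linarith, by linarith⟩
    have h1 := le_pressureTT'Zeeman hβ t t' hU hz hx
    have h2 : pressureTT'Zeeman β t t' U (x + y) hz + β * μ * (x + y) ≤ _ := le_csSup hbdd ⟨x + y, hn, rfl⟩
    rw [show x + y - x = y by ring] at h1
    have e : β * hz * (2 * x - (x + y)) = β * hz * (x - y) := by ring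
    rw [e] at h1
    linarith
  · refine csSup_le ⟨_, ⟨0, ⟨le_rfl, two_pos⟩, rfl⟩⟩ ?_
    rintro _ ⟨n, hn, rfl⟩
    exact pressureTT'Zeeman_add_le_gcPressureTT'Zeeman hβ t t' hU μ hz hn.1 hn.2

omit hβ in
/-- **A supporting chemical potential at every interior filling** (`β > 0`, `0 < n < 2`): there is `μ` with
`P(μ,h) = p(n,h) + βμn` (a supergradient of the concave `n ↦ p(n,h)`, Rockafellar Thm. 23.4).
[cite: Rockafellar1970, Thm. 23.4] -/
theorem exists_chemicalPotential_gcPressureTT'Zeeman_eq (hβ : 0 < β) (hz : ℝ) {n : ℝ} (hn0 : 0 < n) (hn2 : n < 2) :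
    ∃ μ : ℝ, gcPressureTT'Zeeman β t t' U μ hz = pressureTT'Zeeman β t t' U n hz + β * μ * n := by
  have hconv : ConvexOn ℝ (Set.Ico (0 : ℝ) 2) (fun m : ℝ => -pressureTT'Zeeman β t t' U m hz) :=
    (concaveOn_pressureTT'Zeeman_density hβ.le t t' hU hz).neg
  obtain ⟨s, hs⟩ := hconv.exists_supporting_slope ⟨hn0.le, hn2⟩ ⟨n / 2, ⟨by linarith, by linarith⟩, by linarith⟩
    ⟨(n + 2) / 2, ⟨by linarith, by linarith⟩, by linarith⟩
  refine ⟨s / β, le_antisymm ?_ ?_⟩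
  · rw [gcPressureTT'Zeeman_eq_sSup_pressureTT'Zeeman hβ.le t t' hU]
    refine csSup_le ⟨_, ⟨0, ⟨le_rfl, two_pos⟩, rfl⟩⟩ ?_
    rintro _ ⟨m, hm, rfl⟩
    have h := hs m hm
    have hμ : β * (s / β) = s := by field_simp
    calc pressureTT'Zeeman β t t' U m hz + β * (s / β) * m
        = pressureTT'Zeeman β t t' U m hz + s * m := by rw [hμ]
      _ ≤ pressureTT'Zeeman β t t' U n hz + s * n := by linarith
      _ = pressureTT'Zeeman β t t' U n hz + β * (s / β) * n := by rw [hμ]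
  · exact pressureTT'Zeeman_add_le_gcPressureTT'Zeeman hβ.le t t' hU _ hz hn0.le hn2

omit hβ in
/-- **Fenchel–Moreau for the canonical field pressure**: `p(β; n, h) = inf_μ [P(β; μ, h) − βμn]` at every interior
filling (`β > 0`, `0 < n < 2`; the infimum is attained). [cite: Rockafellar1970, Thm. 12.2] -/
theorem pressureTT'Zeeman_eq_ciInf (hβ : 0 < β) (hz : ℝ) {n : ℝ} (hn0 : 0 < n) (hn2 : n < 2) :
    pressureTT'Zeeman β t t' U n hz = ⨅ μ : ℝ, (gcPressureTT'Zeeman β t t' U μ hz - β * μ * n) := by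
  have hbdd : BddBelow (Set.range fun μ : ℝ => gcPressureTT'Zeeman β t t' U μ hz - β * μ * n) :=
    ⟨pressureTT'Zeeman β t t' U n hz, by
      rintro _ ⟨μ, rfl⟩
      have := pressureTT'Zeeman_add_le_gcPressureTT'Zeeman hβ.le t t' hU μ hz hn0.le hn2
      linarith⟩
  obtain ⟨μ₀, hμ₀⟩ := exists_chemicalPotential_gcPressureTT'Zeeman_eq t t' hU hβ hz hn0 hn2
  refine le_antisymm (le_ciInf fun μ => ?_) ?_
  · have := pressureTT'Zeeman_add_le_gcPressureTT'Zeeman hβ.le t t' hU μ hz hn0.le hn2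
    linarith
  · refine (ciInf_le hbdd μ₀).trans ?_
    rw [hμ₀]; simp

end Legendre

end ThermodynamicLimit

end Literature.MathematicalPhysics.QuantumLattice
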